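import Summits.Ventures.GridStability.Models.WSCC9SP
import Summits.Ventures.GridStability.Lyapunov.StructurePreservingPolytopeRoa
import Summits.Ventures.GridStability.Lyapunov.StructurePreservingPolytopeLevel
import HarnessLib

/-!
# GridStability/Bench/WSCC9SPPolytopeRoa — the 9-node STRUCTURE-PRESERVING WSCC canary «WSCC9-SP9»
# (post-fault network B, column V1) on Vu–Turitsyn's polytope: certified synchronisation region at the
# RATIONAL level `c = 29/5` (solver-free; every damping vector `D > 0`) — census TWIN of the NE39 rider

Cell `gridfusion` (LADDER-GRIDFUSION), seat gridfusion-lyap-1 (g6); #91-cand «G2.b-SP-POLYTOPE-THM» /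
rider «#91′ NE39SP-POLYTOPE-19» (lead RULING 6o). THIS FILE is the second instance of the generic
theorem `Lyapunov.StructurePreserving.vtSublevel_subset_regionOfAttraction` (p533955) on a DIFFERENT
topology — the 9-node TREE network of model-2's canary `Models/WSCC9SP.lean` (MANDATORY LABEL carried:
«census / canary object of the SP–Lur'e lane — a structure-preserving VARIANT of the printed 9-bus
(no Kron reduction, loads as frequency-dependent injections at their buses, lossless lines, printed
losses 0.046 pu relocated to G1 by the lossless model), not a 9-bus sentence and not comparable
like-for-like with the MV-2 (Kron) kernel numbers of G1.b / G1-cct»; data model-4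
`bench/data/WSCC9/sp9/sp9.json` 61008636cbb630ff, network post-B, column V1 OF RECORD for the canary;
[cite: AndersonFouad1977, Table 2.1]; [cite: Padiyar2013, §3.2 eq (3.2)]). INSTANCE BY NAME
(`WSCC9SP.params D`, `srcV`, `tgtV`, `tV1Q`, `wtV1Q`, `δ₀ = halfAngle t`); NO NEW DATA LITERAL: the only
numerals here are the level `29/5` and Mathlib's `π < 3.141593` inside `ratGap`.

THREE COLUMNS. CERTIFIED (kernel, here): `edgeChecks` — on each of the 8 listed edges, over `ℚ` by
ONE `decide`: `t_src·t_tgt > −1`, `0 ≤ ratGap q_e`, `29/5 < wt_e · ratGap q_e`; hence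
`level_lt_edgeGap`: `29/5 < bᵢⱼ·vtGap(δ₀ᵢ − δ₀ⱼ)` on every coupled pair (binding edge G3 – bus 9:
`wt·ratGap = 5.838`; next G2 – bus 7: `6.323`); and the two sentences below at `c = 29/5`. Census
comparison (same data, same Lyapunov function, same leaf): the window threshold of
`WSCC9SP.roa_of_lt_levelBound` is `c⋆(θ, β) ≈ 0.9295` (θ ≈ 17.29°, β = 10000/2399) — ratio of LEVELS
`≈ 6.2`, not of volumes. MODELLED: model-2's WSCC9SP tokens «MV-3 + lossless + MV-RD(0.046 @ slack G1)
+ D⟨declared⟩/D(∀) + V-frozen(V1) + ω_R = 377 printed»; the damping / load-frequency vector `D` is a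
PARAMETER (every statement ∀ `D > 0`). VALIDATED: nothing here. No SDP, no Gram matrix; no sentence of
this file says that the WSCC system or any grid is stable. One bookkeeping def (`hqQ`); no named fact;
standard axioms.
-/

noncomputable section

open Set Filter Topology Real
open Summit.Ventures.GridStability.Models
open Summit.Ventures.GridStability.Models.StructurePreserving
open Summit.Ventures.GridStability.Models.WSCC9SP
open Summit.Ventures.GridStability.Lyapunov.StructurePreserving
open Literature.MathematicalPhysics.PowerSystems.ClassicalModel.LosslessSystem (vtGap)

namespace Summit.Ventures.GridStability.Bench.WSCC9SP

/-- The half-angle-tangent quotient of listed edge `e` over `ℚ` (bookkeeping for the `decide`):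
`q_e = (t_src − t_tgt)/(1 + t_src·t_tgt)` on model-2's literals `tV1Q`, `srcV`, `tgtV` (column V1). -/
def hqQ (e : Fin 8) : ℚ :=
  (WSCC9SP.tV1Q (WSCC9SP.srcV e) - WSCC9SP.tV1Q (WSCC9SP.tgtV e))
    / (1 + WSCC9SP.tV1Q (WSCC9SP.srcV e) * WSCC9SP.tV1Q (WSCC9SP.tgtV e))

/-- **The 8 per-edge kernel checks over `ℚ` (one `decide`)**: `t_src·t_tgt > −1`, the rational gap
bound is nonnegative, and `29/5 < wt_e · ratGap q_e` (column V1). Binding edge: G3 – bus 9 (index 7,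
`wt·ratGap = 5.838`). CERTIFIED column. [cite: VuTuritsyn2016, Appendix 9.3] -/
theorem edgeChecks : ∀ e : Fin 8,
    (-1 : ℚ) < WSCC9SP.tV1Q (WSCC9SP.srcV e) * WSCC9SP.tV1Q (WSCC9SP.tgtV e) ∧
      0 ≤ ratGap (hqQ e) ∧ (29 / 5 : ℚ) < WSCC9SP.wtV1Q e * ratGap (hqQ e) := by
  decide +kernel

/-- The quotient cast to `ℝ` is `hq` of the real half-angle tangents. [folklore] -/
theorem hqQ_cast (e : Fin 8) :
    ((hqQ e : ℚ) : ℝ) = hq (WSCC9SP.t (WSCC9SP.srcV e)) (WSCC9SP.t (WSCC9SP.tgtV e)) := by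
  unfold hqQ hq WSCC9SP.t
  push_cast
  rfl

/-- **The certified per-edge level on EVERY coupled pair**: `29/5 < bᵢⱼ · vtGap(δ₀ᵢ − δ₀ⱼ)` whenever
`bᵢⱼ ≠ 0` (column V1; from `edgeChecks` through `level_of_edgeChecks` and `ratGap_le_vtGap`).
CERTIFIED column. [cite: VuTuritsyn2016, §IV (third construction) and Appendix 9.3] -/
theorem level_lt_edgeGap (D : Fin 9 → ℝ) :
    ∀ i j, (params D).b i j ≠ 0 → (29 / 5 : ℝ) < (params D).b i j * vtGap (WSCC9SP.δ₀ i - WSCC9SP.δ₀ j) := by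
  intro i j hij
  rw [params_b] at hij ⊢
  have hprod : ∀ e, (-1 : ℝ) < WSCC9SP.t (WSCC9SP.srcV e) * WSCC9SP.t (WSCC9SP.tgtV e) := fun e => by
    unfold WSCC9SP.t
    exact_mod_cast (edgeChecks e).1
  have hR0 : ∀ e, 0 ≤ ratGap (hq (WSCC9SP.t (WSCC9SP.srcV e)) (WSCC9SP.t (WSCC9SP.tgtV e))) := fun e => by
    rw [← hqQ_cast, ← ratGap_ratCast]
    exact_mod_cast (edgeChecks e).2.1
  have hc : ∀ e, (29 / 5 : ℝ) < WSCC9SP.wt e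
      * ratGap (hq (WSCC9SP.t (WSCC9SP.srcV e)) (WSCC9SP.t (WSCC9SP.tgtV e))) := fun e => by
    rw [← hqQ_cast, ← ratGap_ratCast]
    unfold WSCC9SP.wt
    have h := (Rat.cast_lt (K := ℝ)).2 (edgeChecks e).2.2
    push_cast at h
    exact h
  exact level_of_edgeChecks WSCC9SP.wt_nonneg hprod hR0 hc hij

/-- The equilibrium line angles are STRICTLY below `π/2` on coupled pairs (`θ = 2·arctan τ_max < π/2`,
model-2's `window` and `theta_bounds`). [folklore] -/
theorem window_strict (D : Fin 9 → ℝ) :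
    ∀ i j, (params D).b i j ≠ 0 → |WSCC9SP.δ₀ i - WSCC9SP.δ₀ j| < π / 2 :=
  fun i j hij => (WSCC9SP.window D i j hij).trans_lt WSCC9SP.theta_bounds.2

/-- **«WSCC9-SP9» (canary) on Vu–Turitsyn's polytope — the certified region (phase-space form), level
`29/5`.** MODEL MV-3 at the WSCC9-SP9 canary (post-B, column V1), for EVERY damping / load-frequency
vector `D > 0`: from every phase point `y = (δ, ω)` with every coupled line angle in the polytope
`|(δᵢ − δⱼ) + (δ₀ᵢ − δ₀ⱼ)| < π`, on the momentum leaf through the equilibrium with zero bus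
pseudo-frequencies, and with energy `V(δ₀; δ, ω) ≤ 29/5`, a global solution of the structure-preserving
field exists, and EVERY global solution from `y` keeps the polytope, the leaf and `V ≤ 29/5` for all
`t ≥ 0` and tends to `(δ₀, 0)`. Canary label as in the header; no sentence here says a grid is stable.
[cite: VuTuritsyn2016, §IV; AndersonFouad1977, Table 2.1] -/
theorem polytope_roa {D : Fin 9 → ℝ} (hD : ∀ i, 0 < D i) {y : (Fin 9 → ℝ) × (Fin 9 → ℝ)}
    (hy : y ∈ vtPolytope (params D) WSCC9SP.δ₀ ∩ constraintSet (params D) WSCC9SP.δ₀ ∧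
      phaseEnergy (params D) WSCC9SP.δ₀ y ≤ 29 / 5) :
    (∃ X : ℝ → (Fin 9 → ℝ) × (Fin 9 → ℝ), X 0 = y ∧
      ∀ T : ℝ, ∀ s ∈ Icc 0 T, HasDerivWithinAt X (phaseField (params D) (X s)) (Icc 0 T) s) ∧
    ∀ X : ℝ → (Fin 9 → ℝ) × (Fin 9 → ℝ), X 0 = y →
      (∀ T : ℝ, ∀ s ∈ Icc 0 T, HasDerivWithinAt X (phaseField (params D) (X s)) (Icc 0 T) s) →
      (∀ s, 0 ≤ s → X s ∈ vtPolytope (params D) WSCC9SP.δ₀ ∩ constraintSet (params D) WSCC9SP.δ₀ ∧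
        phaseEnergy (params D) WSCC9SP.δ₀ (X s) ≤ 29 / 5) ∧ Tendsto X atTop (𝓝 (WSCC9SP.δ₀, 0)) :=
  vtSublevel_subset_regionOfAttraction (wellFormed hD) (by decide) (preconnected D)
    (fun i j => by rw [params_b]; exact b_nonneg i j) (window_strict D) (isSyncEquilibrium D)
    (level_lt_edgeGap D) hy

/-- **The same in the printed second-order vocabulary** [cite: Padiyar2013, §3.2 eqs (3.3)–(3.5)]:
for EVERY `D > 0` and every solution `δ` of the structure-preserving model `params D` AS PRINTED
(model-2's `Params.IsSolution`; `ω₀ = 0` here because `P⁰ := f(δ₀)`) whose initial state has every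
coupled line angle in the polytope, momentum `L(δ(0), δ̇(0)) = L(δ₀, 0)` and energy
`V(δ₀; δ(0), δ̇(0)) ≤ 29/5`: the polytope and `V ≤ 29/5` hold for all `t ≥ 0`, every node angle
converges, `δᵢ(t) → δ₀ᵢ`, and every generator frequency deviation tends to zero, `δ̇ᵢ(t) → 0` (`i` an
internal node). MODEL MV-3 (canary label as in the header); no sentence here says a grid is stable.
[cite: VuTuritsyn2016, §IV; BergenHill1981] -/
theorem polytope_tendsto_of_isSolution {D : Fin 9 → ℝ} (hD : ∀ i, 0 < D i) {δ : ℝ → Fin 9 → ℝ}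
    (hδ : (params D).IsSolution δ)
    (hpol : ∀ i j, (params D).b i j ≠ 0 → |(δ 0 i - δ 0 j) + (WSCC9SP.δ₀ i - WSCC9SP.δ₀ j)| < π)
    (hL : (params D).momentum (δ 0) (fun i => deriv (fun u => δ u i) 0)
      = (params D).momentum WSCC9SP.δ₀ 0)
    (hV : (params D).energy WSCC9SP.δ₀ (δ 0) (fun i => deriv (fun u => δ u i) 0) ≤ 29 / 5) :
    (∀ t, 0 ≤ t →
        (∀ i j, (params D).b i j ≠ 0 → |(δ t i - δ t j) + (WSCC9SP.δ₀ i - WSCC9SP.δ₀ j)| < π) ∧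
        (params D).energy WSCC9SP.δ₀ (δ t) (fun i => deriv (fun u => δ u i) t) ≤ 29 / 5) ∧
      Tendsto δ atTop (𝓝 WSCC9SP.δ₀) ∧
      ∀ i ∈ (params D).gen, Tendsto (fun t => deriv (fun u => δ u i) t) atTop (𝓝 0) := by
  have hs : (params D).shifted.IsSolution δ := by
    rw [(params D).shifted_eq_self_of_P0_eq_pe WSCC9SP.b_symm (WSCC9SP.params_P0 D)]
    exact hδ
  exact tendsto_of_isSolution_vt (wellFormed hD) (by decide) (preconnected D)
    (fun i j => by rw [params_b]; exact b_nonneg i j) (window_strict D) (isSyncEquilibrium D)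
    (level_lt_edgeGap D) hs hpol hL hV

/-- **The equilibrium itself is certified** (the region is a neighbourhood of `(δ₀, 0)` in the leaf):
`(δ₀, 0)` lies in the polytope, on the leaf, with `V = 0 ≤ 29/5`. [folklore] -/
theorem equilibrium_mem_region (D : Fin 9 → ℝ) :
    ((WSCC9SP.δ₀, 0) : (Fin 9 → ℝ) × (Fin 9 → ℝ)) ∈
        vtPolytope (params D) WSCC9SP.δ₀ ∩ constraintSet (params D) WSCC9SP.δ₀ ∧
      phaseEnergy (params D) WSCC9SP.δ₀ ((WSCC9SP.δ₀, 0) : (Fin 9 → ℝ) × (Fin 9 → ℝ)) ≤ 29 / 5 :=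
  equilibrium_mem_vtSublevel (params D) (window_strict D) (by norm_num)

end Summit.Ventures.GridStability.Bench.WSCC9SP

end
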